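import Mathlib
import HarnessLib
import Literature.MathematicalPhysics.QuantumFieldTheory.ConstructiveQFTWave0
import Summits.Ventures.LatticeQCDFlow.Scaling.LatticeEntropy
import Summits.Ventures.LatticeQCDFlow.Scaling.LatticeGibbs

/-!
# LatticeQCDFlow / Scaling — the entropy budget of an exact flow, III: measure form

HONEST FRAMING: exact (Metropolis-corrected) sampling algorithms for lattice gauge theory;
figures of merit are autocorrelation/cost numbers at stated couplings and volumes; no
continuum-physics claim.

Venture `LatticeQCDFlow` (cell pub-lqcd), topic `Scaling`, THEORY-2.md §3.2 v2.4 / §4 row T2-AG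
(theory seat GEN-10).  Part I (`Scaling/EntropyBudget.lean`) proved, on FINITE state spaces,
`ESS(p, q) ≤ C · exp(−D(p ‖ η))` for a model `q ≤ C · η` (`essFrac_le_mul_exp_neg_klFin`).  This
file is the MEASURE-THEORETIC form of the same law, so that it composes with the lattice entropy
growth laws (`Lattice.EntropyGrowth`, `Lattice.SUN.EntropyGrowthLaw`, `Lattice.UN…`, which are
statements about `InformationTheory.klDiv (wilsonMeasure ρ β) Haar^{⊗E}`):

* `essM μ q := (∫ (dμ/dq) dμ)⁻¹` — the effective-sample-size FRACTION of an exact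
  (reweighted / independence-Metropolis) sampler with proposal `q` and target `μ`
  (`= 1 / E_q[w²]` for the normalised weight `w = dμ/dq`; junk value `0` when `dμ/dq ∉ L¹(μ)`,
  which is the honest value: infinite weight variance);
* `toReal_klDiv_le_log_add_log` — for probability measures `μ ≪ η` and a model
  `q = g · η` with a density `0 < g ≤ C`:  `D(μ ‖ η) ≤ log C + log ∫ (dμ/dη)/g dμ`;
* `essM_le_mul_exp_neg_klDiv` — **T2-AG, measure form**: `ESS(μ, g·η) ≤ C · exp(−D(μ ‖ η))`;
* `Lattice.wilson_essM_le` — the same for the Wilson measure `μ_{Λ,β}` of any continuous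
  unitary-type representation against product Haar: for EVERY model density `0 < g ≤ C`
  (w.r.t. `Haar^{⊗E}`), `ESS ≤ C · exp(−D(μ_{Λ,β} ‖ Haar^{⊗E}))`.

Combined with a lattice entropy growth law `D(μ_{Λ,β} ‖ Haar^{⊗E}) ≥ (κ/2)(d−1)V·log β − O(V)`
this is the VOLUME × COUPLING SCALING LAW of exact flow samplers: a flow whose model density is
bounded by `C` (e.g. `log C ≤ (#layers)·V·(log-Lipschitz bound per site)`) has
`ESS ≤ C · β^{−(κ/2)((d−1)V − O(V/L)) + O(1)} · e^{O(V)}` — the density CONCENTRATION capacity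
`log C` must grow like `(κ/2)(d−1)·V·log β` (extensive in the volume, logarithmic in the coupling)
for the ESS not to collapse (`Scaling/EntropyBudgetMeasureSU2.lean` instantiates `κ = 3` for
`SU(2)` unconditionally).  Proof of the inequality: pointwise `log φ ≤ φ/(gZ) − 1 + log g + log Z`
(`log x ≤ x − 1`) for the target density `φ = dμ/dη` and `Z = ∫ φ/g dμ`, integrated against `μ`.
References: Kong (1992) / Liu, *Monte Carlo Strategies* §2.5 (ESS = 1/E_q[w²]); Agapiou,
Papaspiliopoulos, Sanz-Alonso, Stuart, Statist. Sci. 32 (2017) arXiv:1511.06196 Thm 2.1, §2.3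
(necessity of `exp(D(μ‖q))` samples); Chatterjee–Diaconis, Ann. Appl. Probab. 28 (2018)
arXiv:1511.01437 Thm 1.1; Nicoli et al., Phys. Rev. Lett. 126 (2021) 032001 = arXiv:2007.07115
(ESS of lattice flows); Abbott et al. arXiv:2211.07541 §IV (volume scaling of flow ESS).
-/

namespace Summit.Ventures.LatticeQCDFlow.Theory2

open MeasureTheory InformationTheory

variable {Ω : Type*} [MeasurableSpace Ω]

/-- **Continuum ESS fraction** of target `μ` against proposal `q`: `(E_μ[dμ/dq])⁻¹ = 1/E_q[w²]`
for the normalised importance weight `w = dμ/dq` (the large-sample limit of Kong's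
`(∑ wᵢ)²/(n ∑ wᵢ²)`, Liu, *Monte Carlo Strategies in Scientific Computing* §2.5.3); the junk value
`0⁻¹ = 0` when `dμ/dq ∉ L¹(μ)` is the correct one (infinite weight variance). [folklore] -/
noncomputable def essM (μ q : Measure Ω) : ℝ := (∫ x, (μ.rnDeriv q x).toReal ∂μ)⁻¹

/-- `essM` is non-negative. [folklore] -/
theorem essM_nonneg (μ q : Measure Ω) : 0 ≤ essM μ q :=
  inv_nonneg.mpr (integral_nonneg fun _ => ENNReal.toReal_nonneg)

/-- The density of `μ` against the model `g · η` is `(dμ/dη)/g`, `μ`-a.e., for a positive real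
density `g`. [folklore] -/
theorem toReal_rnDeriv_withDensity_ae_eq (η μ : Measure Ω) [SigmaFinite η] [SigmaFinite μ]
    (hμη : μ ≪ η) {g : Ω → ℝ} (hg : Measurable g) (hg0 : ∀ x, 0 < g x) :
    (fun x => (μ.rnDeriv (η.withDensity fun y => ENNReal.ofReal (g y)) x).toReal) =ᵐ[μ]
      fun x => (μ.rnDeriv η x).toReal / g x := by
  have h := Measure.rnDeriv_withDensity_right μ η hg.ennreal_ofReal.aemeasurable
    (ae_of_all _ fun x => (ENNReal.ofReal_pos.mpr (hg0 x)).ne')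
    (ae_of_all _ fun x => ENNReal.ofReal_ne_top)
  filter_upwards [hμη.ae_le h] with x hx
  rw [hx, ENNReal.toReal_mul, ENNReal.toReal_inv, ENNReal.toReal_ofReal (hg0 x).le,
    div_eq_inv_mul]

/-- The target density `dμ/dη` is positive and finite `μ`-a.e. (as a real number). [folklore] -/
theorem toReal_rnDeriv_pos_ae (η μ : Measure Ω) [SigmaFinite η] [SigmaFinite μ] (hμη : μ ≪ η) :
    ∀ᵐ x ∂μ, 0 < (μ.rnDeriv η x).toReal := by
  filter_upwards [Measure.rnDeriv_pos hμη, hμη.ae_le (Measure.rnDeriv_lt_top μ η)] with x h0 ht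
  exact ENNReal.toReal_pos h0.ne' ht.ne

/-- `Z = ∫ (dμ/dη)/g dμ > 0` for a probability measure `μ ≪ η` and a positive `g`, as soon as
the integrand is integrable. [folklore] -/
theorem integral_rnDeriv_div_pos (η μ : Measure Ω) [SigmaFinite η] [IsProbabilityMeasure μ]
    (hμη : μ ≪ η) {g : Ω → ℝ} (hg0 : ∀ x, 0 < g x)
    (hw : Integrable (fun x => (μ.rnDeriv η x).toReal / g x) μ) :
    0 < ∫ x, (μ.rnDeriv η x).toReal / g x ∂μ := by
  set F : Ω → ℝ := fun x => (μ.rnDeriv η x).toReal / g x with hF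
  have hF0 : 0 ≤ᵐ[μ] F := ae_of_all _ fun x => div_nonneg ENNReal.toReal_nonneg (hg0 x).le
  rw [integral_pos_iff_support_of_nonneg_ae hF0 hw]
  have hmem : ∀ᵐ x ∂μ, x ∈ Function.support F := by
    filter_upwards [toReal_rnDeriv_pos_ae η μ hμη] with x hx
    exact (div_pos hx (hg0 x)).ne'
  have h0 : μ (Function.support F)ᶜ = 0 := ae_iff.mp hmem
  rw [measure_congr (ae_eq_univ.mpr h0), measure_univ]
  exact one_pos

/-- **The log-density budget** (measure form of `klFin_le_klFin_add_log` + Gibbs): for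
probability measures `μ ≪ η` with `llr μ η ∈ L¹(μ)` and a model density `0 < g ≤ C` w.r.t.
`η`, `D(μ ‖ η) ≤ log C + log ∫ (dμ/dη)/g dμ`.  Proof: with `φ = dμ/dη`, `Z = ∫ φ/g dμ`,
pointwise `log φ = log(φ/(gZ)) + log g + log Z ≤ (φ/(gZ) − 1) + log C + log Z`, then integrate
against `μ`. [folklore] -/
theorem toReal_klDiv_le_log_add_log (η μ : Measure Ω) [IsProbabilityMeasure η]
    [IsProbabilityMeasure μ] (hμη : μ ≪ η) (hllr : Integrable (llr μ η) μ) {g : Ω → ℝ} {C : ℝ}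
    (hg0 : ∀ x, 0 < g x) (hgC : ∀ x, g x ≤ C)
    (hw : Integrable (fun x => (μ.rnDeriv η x).toReal / g x) μ) :
    (klDiv μ η).toReal ≤ Real.log C + Real.log (∫ x, (μ.rnDeriv η x).toReal / g x ∂μ) := by
  set φ : Ω → ℝ := fun x => (μ.rnDeriv η x).toReal with hφ
  set Z : ℝ := ∫ x, φ x / g x ∂μ with hZ
  have hZpos : 0 < Z := integral_rnDeriv_div_pos η μ hμη hg0 hw
  -- the pointwise inequality
  have hpt : ∀ᵐ x ∂μ, llr μ η x ≤ (φ x / g x / Z - 1) + (Real.log C + Real.log Z) := by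
    filter_upwards [toReal_rnDeriv_pos_ae η μ hμη] with x hx
    have hgx := hg0 x
    have h1 : Real.log (φ x) = Real.log (φ x / g x / Z) + Real.log (g x) + Real.log Z := by
      rw [Real.log_div (div_pos hx hgx).ne' hZpos.ne', Real.log_div hx.ne' hgx.ne']
      ring
    have h2 : Real.log (φ x / g x / Z) ≤ φ x / g x / Z - 1 :=
      Real.log_le_sub_one_of_pos (div_pos (div_pos hx hgx) hZpos)
    have h3 : Real.log (g x) ≤ Real.log C := Real.log_le_log hgx (hgC x)
    rw [llr_def]
    change Real.log (φ x) ≤ _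
    linarith
  -- integrate against `μ`
  have hR1 : Integrable (fun x => φ x / g x / Z - 1) μ := (hw.div_const Z).sub (integrable_const _)
  have hR : Integrable (fun x => (φ x / g x / Z - 1) + (Real.log C + Real.log Z)) μ :=
    hR1.add (integrable_const _)
  have hint := integral_mono_ae hllr hR hpt
  rw [integral_add hR1 (integrable_const _), integral_sub (hw.div_const Z) (integrable_const _),
    integral_div, integral_const, integral_const, probReal_univ, one_smul, one_smul,
    div_self hZpos.ne', sub_self, zero_add] at hint
  rwa [toReal_klDiv_of_measure_eq hμη (by rw [measure_univ, measure_univ])]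

/-- A probability measure lives on a nonempty type. [folklore] -/
theorem nonempty_of_isProbabilityMeasure (μ : Measure Ω) [IsProbabilityMeasure μ] : Nonempty Ω := by
  by_contra h
  haveI : IsEmpty Ω := not_nonempty_iff.mp h
  exact IsProbabilityMeasure.ne_zero μ (Measure.eq_zero_of_isEmpty μ)

/-- **T2-AG, measure form (ENTROPY ⇒ ESS).**  For probability measures `μ ≪ η` with
`llr μ η ∈ L¹(μ)` and ANY model `q = g · η` with a measurable density `0 < g ≤ C`:
`ESS(μ, q) ≤ C · exp(−D(μ ‖ η))` — the target's entropy deficit relative to the reference must be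
paid for by density CONCENTRATION of the model (its sup-density `C`).  No integrability of the
weight is assumed: when `dμ/dq ∉ L¹(μ)` the ESS is `0`. [folklore] -/
theorem essM_le_mul_exp_neg_klDiv (η μ : Measure Ω) [IsProbabilityMeasure η]
    [IsProbabilityMeasure μ] (hμη : μ ≪ η) (hllr : Integrable (llr μ η) μ) {g : Ω → ℝ}
    (hg : Measurable g) {C : ℝ} (hg0 : ∀ x, 0 < g x) (hgC : ∀ x, g x ≤ C) :
    essM μ (η.withDensity fun x => ENNReal.ofReal (g x)) ≤ C * Real.exp (-(klDiv μ η).toReal) := by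
  obtain ⟨x₀⟩ := nonempty_of_isProbabilityMeasure μ
  have hC : 0 < C := (hg0 x₀).trans_le (hgC x₀)
  unfold essM
  rw [integral_congr_ae (toReal_rnDeriv_withDensity_ae_eq η μ hμη hg hg0)]
  by_cases hw : Integrable (fun x => (μ.rnDeriv η x).toReal / g x) μ
  · set Z : ℝ := ∫ x, (μ.rnDeriv η x).toReal / g x ∂μ with hZ
    have hZpos : 0 < Z := integral_rnDeriv_div_pos η μ hμη hg0 hw
    have hlog := toReal_klDiv_le_log_add_log η μ hμη hllr hg0 hgC hw
    have h1 : Real.exp (-(Real.log C + Real.log Z)) ≤ Real.exp (-(klDiv μ η).toReal) :=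
      Real.exp_le_exp.mpr (by linarith)
    rw [neg_add, Real.exp_add, Real.exp_neg, Real.exp_neg, Real.exp_log hC, Real.exp_log hZpos]
      at h1
    calc Z⁻¹ = C * (C⁻¹ * Z⁻¹) := by field_simp
      _ ≤ C * Real.exp (-(klDiv μ η).toReal) := mul_le_mul_of_nonneg_left h1 hC.le
  · rw [integral_undef hw, inv_zero]
    positivity

/-- The budget read as a CAPACITY LAW: `log(1/ESS) ≥ D(μ ‖ η) − log C`, i.e. a sampler with
`ESS ≥ e^{−t}` needs model sup-density `log C ≥ D(μ ‖ η) − t`. [folklore] -/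
theorem toReal_klDiv_sub_le_log_inv_essM (η μ : Measure Ω) [IsProbabilityMeasure η]
    [IsProbabilityMeasure μ] (hμη : μ ≪ η) (hllr : Integrable (llr μ η) μ) {g : Ω → ℝ}
    (hg : Measurable g) {C : ℝ} (hg0 : ∀ x, 0 < g x) (hgC : ∀ x, g x ≤ C)
    (hess : 0 < essM μ (η.withDensity fun x => ENNReal.ofReal (g x))) :
    (klDiv μ η).toReal - Real.log C ≤
      Real.log (essM μ (η.withDensity fun x => ENNReal.ofReal (g x)))⁻¹ := by
  obtain ⟨x₀⟩ := nonempty_of_isProbabilityMeasure μ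
  have hC : 0 < C := (hg0 x₀).trans_le (hgC x₀)
  have h := essM_le_mul_exp_neg_klDiv η μ hμη hllr hg hg0 hgC
  have h2 : Real.log (essM μ (η.withDensity fun x => ENNReal.ofReal (g x))) ≤
      Real.log C + -(klDiv μ η).toReal := by
    rw [← Real.log_exp (-(klDiv μ η).toReal), ← Real.log_mul hC.ne' (Real.exp_pos _).ne']
    exact Real.log_le_log hess h
  rw [Real.log_inv]
  linarith

end Summit.Ventures.LatticeQCDFlow.Theory2

/-! ## The Wilson measure against product Haar -/

namespace Summit.Ventures.LatticeQCDFlow.Theory2.Lattice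

open MeasureTheory InformationTheory Literature.MathematicalPhysics.QuantumFieldTheory

variable {N : ℕ} {G : Type*} [Group G] [TopologicalSpace G] [IsTopologicalGroup G]
  [CompactSpace G] [SecondCountableTopology G] [MeasurableSpace G] [BorelSpace G]
  (ρ : G →* Matrix (Fin N) (Fin N) ℂ)

/-- For `β ≥ 0` and a continuous `ρ` with `Re tr ρ ≤ N` the Wilson measure is a probability
measure, absolutely continuous w.r.t. product Haar, with an integrable log-likelihood ratio
(`= log Z⁻¹ − β S` a.e., `S` bounded).  (The three facts are extracted from the proof of
`gibbsIdentity`.) [folklore] -/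
theorem wilsonMeasure_ac_integrable_llr {d L : ℕ} [NeZero L]
    (hρ : Continuous (ρ : G → Matrix (Fin N) (Fin N) ℂ)) (htr : ∀ g, (ρ g).trace.re ≤ N)
    {β : ℝ} (hβ : 0 ≤ β) :
    IsProbabilityMeasure (wilsonMeasure (d := d) (L := L) ρ β) ∧
      wilsonMeasure (d := d) (L := L) ρ β ≪ (Measure.pi fun _ : Edge d L => haarProbability G) ∧
      Integrable (llr (wilsonMeasure (d := d) (L := L) ρ β)
          (Measure.pi fun _ : Edge d L => haarProbability G))
        (wilsonMeasure (d := d) (L := L) ρ β) := by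
  set π : Measure (GaugeConfig d L G) := Measure.pi fun _ : Edge d L => haarProbability G with hπ
  have hf := measurable_wilsonDensity (d := d) (L := L) ρ hρ β
  have hZtop : partitionFunction (d := d) (L := L) ρ β ≠ ⊤ :=
    ne_top_of_le_ne_top ENNReal.one_ne_top (partitionFunction_le_one ρ htr hβ)
  have hZ0 : partitionFunction (d := d) (L := L) ρ β ≠ 0 := partitionFunction_ne_zero ρ hρ β
  have hSc := continuous_wilsonAction (d := d) (L := L) ρ hρ
  haveI : IsFiniteMeasure (wilsonWeight (d := d) (L := L) ρ β) :=
    ⟨lt_top_iff_ne_top.mpr hZtop⟩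
  haveI hμ : IsProbabilityMeasure (wilsonMeasure (d := d) (L := L) ρ β) := ⟨by
    show ((partitionFunction ρ β)⁻¹ • wilsonWeight ρ β) Set.univ = 1
    rw [Measure.smul_apply, smul_eq_mul]
    exact ENNReal.inv_mul_cancel hZ0 hZtop⟩
  have hac : wilsonMeasure (d := d) (L := L) ρ β ≪ π :=
    Measure.smul_absolutelyContinuous.trans (withDensity_absolutelyContinuous π _)
  have h1 : (wilsonMeasure (d := d) (L := L) ρ β).rnDeriv π =ᵐ[π]
      (partitionFunction (d := d) (L := L) ρ β)⁻¹ •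
        (wilsonWeight (d := d) (L := L) ρ β).rnDeriv π :=
    Measure.rnDeriv_smul_left_of_ne_top' _ _ (ENNReal.inv_ne_top.mpr hZ0)
  have h2 : (wilsonWeight (d := d) (L := L) ρ β).rnDeriv π =ᵐ[π]
      fun U => ENNReal.ofReal (Real.exp (-β * wilsonAction ρ U)) :=
    Measure.rnDeriv_withDensity π hf
  have hzpos : 0 < ((partitionFunction (d := d) (L := L) ρ β)⁻¹).toReal :=
    ENNReal.toReal_pos (ENNReal.inv_ne_zero.mpr hZtop) (ENNReal.inv_ne_top.mpr hZ0)
  have h_llr : llr (wilsonMeasure (d := d) (L := L) ρ β) π =ᵐ[wilsonMeasure (d := d) (L := L) ρ β]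
      fun U => Real.log ((partitionFunction (d := d) (L := L) ρ β)⁻¹).toReal +
        (-β) * wilsonAction ρ U := by
    filter_upwards [hac.ae_eq h1, hac.ae_eq h2] with U h1U h2U
    rw [llr_def]
    beta_reduce
    rw [h1U, Pi.smul_apply, smul_eq_mul, h2U, ENNReal.toReal_mul,
      ENNReal.toReal_ofReal (Real.exp_nonneg _), Real.log_mul hzpos.ne' (Real.exp_pos _).ne',
      Real.log_exp]
  obtain ⟨B, hB⟩ := isCompact_univ.exists_bound_of_continuousOn (hSc.continuousOn (s := Set.univ))
  have hSint : Integrable (wilsonAction (d := d) (L := L) ρ)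
      (wilsonMeasure (d := d) (L := L) ρ β) :=
    Integrable.of_bound hSc.aestronglyMeasurable B (ae_of_all _ fun U => hB U (Set.mem_univ U))
  have hg : Integrable (fun U => Real.log ((partitionFunction (d := d) (L := L) ρ β)⁻¹).toReal +
      (-β) * wilsonAction ρ U) (wilsonMeasure (d := d) (L := L) ρ β) :=
    (integrable_const _).add (hSint.const_mul _)
  exact ⟨hμ, hac, hg.congr h_llr.symm⟩

/-- **T2-AG on the lattice (ENTROPY ⇒ ESS for the Wilson measure).**  For `β ≥ 0`, a continuous
`ρ` with `Re tr ρ ≤ N` on a compact second-countable `G`, and ANY model on `GaugeConfig d L G`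
with a measurable density `0 < g ≤ C` w.r.t. product Haar (e.g. the push-forward of product Haar
under a flow with bounded log-Jacobian capacity), the exact sampler's ESS fraction obeys
`ESS ≤ C · exp(−D(μ_{Λ,β} ‖ Haar^{⊗E}))`. [folklore] -/
theorem wilson_essM_le {d L : ℕ} [NeZero L]
    (hρ : Continuous (ρ : G → Matrix (Fin N) (Fin N) ℂ)) (htr : ∀ g, (ρ g).trace.re ≤ N)
    {β : ℝ} (hβ : 0 ≤ β) {g : GaugeConfig d L G → ℝ} (hg : Measurable g) {C : ℝ}
    (hg0 : ∀ U, 0 < g U) (hgC : ∀ U, g U ≤ C) :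
    essM (wilsonMeasure (d := d) (L := L) ρ β)
        ((Measure.pi fun _ : Edge d L => haarProbability G).withDensity
          fun U => ENNReal.ofReal (g U)) ≤
      C * Real.exp (-(klDiv (wilsonMeasure (d := d) (L := L) ρ β)
        (Measure.pi fun _ : Edge d L => haarProbability G)).toReal) := by
  obtain ⟨hμ, hac, hllr⟩ := wilsonMeasure_ac_integrable_llr (d := d) (L := L) ρ hρ htr hβ
  exact essM_le_mul_exp_neg_klDiv _ _ hac hllr hg hg0 hgC

/-- **The volume × coupling law of exact flow samplers, abstract form.**  If the entropy of the
Wilson measure relative to product Haar grows as `D ≥ s · log β − c · L^d` (an entropy growth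
law with `s = (κ/2)·((d−1)L^d(1 − 2/L) − 1)`, `κ = dim G`), then every model of sup-density `C`
has `ESS ≤ C · e^{c L^d} · β^{−s}`. [folklore] -/
theorem wilson_essM_le_rpow {d L : ℕ} [NeZero L]
    (hρ : Continuous (ρ : G → Matrix (Fin N) (Fin N) ℂ)) (htr : ∀ g, (ρ g).trace.re ≤ N)
    {β s c : ℝ} (hβ : 1 ≤ β)
    (hD : s * Real.log β - c * (L : ℝ) ^ d ≤ (klDiv (wilsonMeasure (d := d) (L := L) ρ β)
        (Measure.pi fun _ : Edge d L => haarProbability G)).toReal)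
    {g : GaugeConfig d L G → ℝ} (hg : Measurable g) {C : ℝ}
    (hg0 : ∀ U, 0 < g U) (hgC : ∀ U, g U ≤ C) :
    essM (wilsonMeasure (d := d) (L := L) ρ β)
        ((Measure.pi fun _ : Edge d L => haarProbability G).withDensity
          fun U => ENNReal.ofReal (g U)) ≤
      C * Real.exp (c * (L : ℝ) ^ d) * β ^ (-s) := by
  have hβ0 : 0 < β := one_pos.trans_le hβ
  have hC : 0 < C := (hg0 fun _ => 1).trans_le (hgC fun _ => 1)
  have h := wilson_essM_le (d := d) (L := L) ρ hρ htr hβ0.le hg hg0 hgC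
  refine h.trans ?_
  rw [mul_assoc]
  refine mul_le_mul_of_nonneg_left ?_ hC.le
  rw [Real.rpow_def_of_pos hβ0, ← Real.exp_add]
  exact Real.exp_le_exp.mpr (by linarith)

end Summit.Ventures.LatticeQCDFlow.Theory2.Lattice
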